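import Literature.NumberTheory.LFunctions.Lagarias1999.Question
import Mathlib.NumberTheory.LSeries.Dirichlet
import Mathlib.Analysis.SpecialFunctions.Gamma.Deriv
import Mathlib.Analysis.SpecialFunctions.Pow.Deriv
import Mathlib.Analysis.Normed.Module.FiniteDimension
import Literature.NumberTheory.QuadraticFields.QuadraticDedekindZeta
import HarnessLib

/-!
# Lagarias (1999) — `ξ_K'/ξ_K` of an imaginary quadratic field

For a number field `K`, Lagarias [LagariasXiPositivity1999, (1.13), (2.13)] writes
`ξ_K(s) = ½ s(s−1) A_K^s Γ(s/2)^{r₁} Γ(s)^{r₂} ζ_K(s)` and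
`ξ_K'/ξ_K(s) = log A_K + 1/s + 1/(s−1) + (r₁/2) ψ(s/2) + r₂ ψ(s) + ζ_K'/ζ_K(s)`.
This file proves the case used in the refutation of the question of pp. 220–221
(`Lagarias1999.Refutation`): for an imaginary quadratic field `K` with odd discriminant
(`r₁ = 0`, `r₂ = 1`, `ζ_K = ζ · L(·, χ)` with `χ = (·/|d_K|)` by
`Literature.NumberTheory.QuadraticFields.dedekindZeta_eq_riemannZeta_mul_LSeries`) and `Re s > 1`,

`ξ_K'/ξ_K(s) = 1/s + 1/(s−1) + log A_K + ψ(s) − Σ_n Λ(n) n^{−s} − Σ_n χ(n) Λ(n) n^{−s}`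

(`logDeriv_xi_eq`; `ξ_K = Lagarias1999.xi`, `ψ = Complex.digamma`), from the logarithmic
derivatives of the prefactor `½ s(s−1) A^s Γ(s)` and of `ζ`, `L(·, χ)` (Mathlib).
-/

open Complex Filter Topology NumberField NumberField.InfinitePlace
open scoped LSeries.notation ArithmeticFunction.vonMangoldt NumberTheorySymbols
open Literature.NumberTheory.QuadraticFields Literature.NumberTheory.QuadraticFields.Quadratic

namespace Literature.NumberTheory.LFunctions.Lagarias1999

/-! ## The logarithmic derivative of the prefactor `½ s(s−1) A^s Γ(s)` -/

/-- `logDeriv` is local: eventually equal functions have the same logarithmic derivative.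
[folklore] -/
private theorem logDeriv_congr_of_eventuallyEq {f g : ℂ → ℂ} {s : ℂ} (h : f =ᶠ[𝓝 s] g) :
    logDeriv f s = logDeriv g s := by
  rw [logDeriv_apply, logDeriv_apply, h.deriv_eq, h.eq_of_nhds]

/-- `(d/ds) log (A^s) = log A` for a real `A > 0`. [folklore] -/
private theorem logDeriv_const_cpow {A : ℝ} (hA : 0 < A) (s : ℂ) :
    logDeriv (fun z : ℂ => (A : ℂ) ^ z) s = Real.log A := by
  have hA0 : (A : ℂ) ≠ 0 := ofReal_ne_zero.mpr hA.ne'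
  have hd : HasDerivAt (fun z : ℂ => (A : ℂ) ^ z) ((A : ℂ) ^ s * Complex.log A) s := by
    simpa using (hasDerivAt_id s).const_cpow (Or.inl hA0)
  have hne : (A : ℂ) ^ s ≠ 0 := by
    rw [cpow_def_of_ne_zero hA0]; exact exp_ne_zero _
  rw [logDeriv_apply, hd.deriv, mul_div_cancel_left₀ _ hne, (ofReal_log hA.le).symm]

/-- `(d/ds) log (½ s (s − 1)) = 1/s + 1/(s − 1)` away from `0, 1`. [folklore] -/
private theorem logDeriv_half_mul_self_mul_sub_one {s : ℂ} (h0 : s ≠ 0) (h1 : s ≠ 1) :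
    logDeriv (fun z : ℂ => 1 / 2 * z * (z - 1)) s = 1 / s + 1 / (s - 1) := by
  have h1' : s - 1 ≠ 0 := sub_ne_zero.mpr h1
  have hA : logDeriv (fun z : ℂ => 1 / 2 * z) s = 1 / s := by
    rw [logDeriv_const_mul s (1 / 2 : ℂ) (by norm_num)]
    exact logDeriv_id' s
  have hB : logDeriv (fun z : ℂ => z - 1) s = 1 / (s - 1) := by
    rw [logDeriv_apply, deriv_sub_const, deriv_id'']
  have := logDeriv_mul (f := fun z : ℂ => 1 / 2 * z) (g := fun z : ℂ => z - 1) s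
    (by simpa using h0) h1' (by fun_prop) (by fun_prop)
  rw [hA, hB] at this
  simpa [one_div] using this

/-- The logarithmic derivative of the archimedean prefactor of `ξ_K` for a field with
`r₁ = 0, r₂ = 1`: `(d/ds) log (½ s(s−1) A^s Γ(s)) = 1/s + 1/(s−1) + log A + ψ(s)` for `Re s > 0`,
`s ≠ 1`. [cite: LagariasXiPositivity1999, (2.13)] -/
theorem logDeriv_prefactor {A : ℝ} (hA : 0 < A) {s : ℂ} (hs : 0 < s.re) (h1 : s ≠ 1) :
    logDeriv (fun z : ℂ => 1 / 2 * z * (z - 1) * (A : ℂ) ^ z * Complex.Gamma z) s =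
      1 / s + 1 / (s - 1) + Real.log A + digamma s := by
  have h0 : s ≠ 0 := fun h => by rw [h, zero_re] at hs; exact lt_irrefl _ hs
  have h1' : s - 1 ≠ 0 := sub_ne_zero.mpr h1
  have hA0 : (A : ℂ) ≠ 0 := ofReal_ne_zero.mpr hA.ne'
  have hAs : (A : ℂ) ^ s ≠ 0 := by rw [cpow_def_of_ne_zero hA0]; exact exp_ne_zero _
  have hsm : ∀ m : ℕ, s ≠ -(m : ℂ) := by
    intro m h
    rw [h, neg_re, natCast_re] at hs
    have := (Nat.cast_nonneg m : (0 : ℝ) ≤ m); linarith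
  have hG0 : Complex.Gamma s ≠ 0 := Complex.Gamma_ne_zero hsm
  have hGd : DifferentiableAt ℂ Complex.Gamma s := Complex.differentiableAt_Gamma s hsm
  have hPd : DifferentiableAt ℂ (fun z : ℂ => 1 / 2 * z * (z - 1)) s := by fun_prop
  have hP0 : (1 / 2 * s * (s - 1) : ℂ) ≠ 0 := by
    refine mul_ne_zero (mul_ne_zero (by norm_num) h0) h1'
  have hCd : DifferentiableAt ℂ (fun z : ℂ => (A : ℂ) ^ z) s :=
    differentiableAt_id.const_cpow (Or.inl hA0)
  -- `(½ z (z−1)) · A^z`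
  have hPC := logDeriv_mul (f := fun z : ℂ => 1 / 2 * z * (z - 1)) (g := fun z : ℂ => (A : ℂ) ^ z)
    s hP0 hAs hPd hCd
  rw [logDeriv_half_mul_self_mul_sub_one h0 h1, logDeriv_const_cpow hA] at hPC
  -- `(…) · Γ z`
  have hPCd : DifferentiableAt ℂ (fun z : ℂ => 1 / 2 * z * (z - 1) * (A : ℂ) ^ z) s := hPd.mul hCd
  have hPC0 : (1 / 2 * s * (s - 1) * (A : ℂ) ^ s : ℂ) ≠ 0 := mul_ne_zero hP0 hAs
  have hall := logDeriv_mul (f := fun z : ℂ => 1 / 2 * z * (z - 1) * (A : ℂ) ^ z)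
    (g := Complex.Gamma) s hPC0 hG0 hPCd hGd
  rw [hPC, ← Complex.digamma_def] at hall
  simpa [Pi.div_apply] using hall

/-! ## The logarithmic derivative of `ξ_K` for an imaginary quadratic field of odd discriminant -/

variable {K : Type*} [Field K] [NumberField K]

/-- `A_K > 0`. [cite: LagariasXiPositivity1999, (1.13)] -/
theorem lagariasA_pos : 0 < lagariasA K := by
  unfold lagariasA
  refine mul_pos (mul_pos (Real.rpow_pos_of_pos Real.pi_pos _)
    (Real.rpow_pos_of_pos (by positivity) _)) (Real.sqrt_pos.mpr ?_)
  exact abs_pos.mpr (Int.cast_ne_zero.mpr (discr_ne_zero K))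

/-- For an imaginary quadratic field (`r₁ = 0`, `r₂ = 1`), `ξ_K(s) = ½ s (s−1) A_K^s Γ(s) ζ_K(s)`.
[cite: LagariasXiPositivity1999, (1.13)] -/
theorem xi_eq_of_imaginary_quadratic (h2 : Module.finrank ℚ K = 2) (hd : discr K < 0) :
    xi K = fun s : ℂ =>
      (1 / 2 * s * (s - 1) * (lagariasA K : ℂ) ^ s * Complex.Gamma s) * dedekindZeta K s := by
  obtain ⟨hr1, hr2⟩ := nrRealPlaces_eq_zero_and_nrComplexPlaces_eq_one h2 hd
  funext s
  simp [xi, hr1, hr2]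

/-- **`ξ_K'/ξ_K` for an imaginary quadratic field with odd discriminant** (`r₁ = 0`, `r₂ = 1`,
`ζ_K = ζ · L(·, χ)` with `χ = (·/|d_K|)`): for `Re s > 1`,
`ξ_K'/ξ_K(s) = 1/s + 1/(s−1) + log A_K + ψ(s) − Σ_n Λ(n) n^{−s} − Σ_n χ(n)Λ(n) n^{−s}`.
This is Lagarias's (2.13) with `ζ_K'/ζ_K = −Σ Λ_K(n) n^{−s}`, `Λ_K(n) = Λ(n)(1 + χ(n))` ((2.14)).
[cite: LagariasXiPositivity1999, (2.13)–(2.14)] -/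
theorem logDeriv_xi_eq [NeZero (discr K).natAbs] (h2 : Module.finrank ℚ K = 2) (hd : discr K < 0)
    (hodd : Odd (discr K)) {s : ℂ} (hs : 1 < s.re) :
    logDeriv (xi K) s = 1 / s + 1 / (s - 1) + Real.log (lagariasA K) + digamma s
      - L ↗Λ s - L (↗(jacobiChar (discr K).natAbs) * ↗Λ) s := by
  set χ := jacobiChar (discr K).natAbs with hχ
  have h1 : s ≠ 1 := fun h => by rw [h, one_re] at hs; exact lt_irrefl _ hs
  have hs0 : 0 < s.re := by linarith
  -- `ξ_K` agrees near `s` with `pref · (ζ · L(χ))`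
  set pref : ℂ → ℂ := fun z => 1 / 2 * z * (z - 1) * (lagariasA K : ℂ) ^ z * Complex.Gamma z
    with hpref
  have hU : IsOpen {z : ℂ | 1 < z.re} := isOpen_lt continuous_const continuous_re
  have hev : xi K =ᶠ[𝓝 s] fun z => pref z * (riemannZeta z * L ↗χ z) := by
    filter_upwards [hU.mem_nhds hs] with z hz
    rw [xi_eq_of_imaginary_quadratic h2 hd]
    simp only [hpref]
    rw [dedekindZeta_eq_riemannZeta_mul_LSeries h2 hodd hz]
  rw [logDeriv_congr_of_eventuallyEq hev]
  -- nonvanishing and differentiability of the three factors at `s`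
  have hsm : ∀ m : ℕ, s ≠ -(m : ℂ) := by
    intro m h
    rw [h, neg_re, natCast_re] at hs0
    have := (Nat.cast_nonneg m : (0 : ℝ) ≤ m); linarith
  have hA0 : (lagariasA K : ℂ) ≠ 0 := ofReal_ne_zero.mpr (lagariasA_pos (K := K)).ne'
  have hpref0 : pref s ≠ 0 := by
    simp only [hpref]
    refine mul_ne_zero (mul_ne_zero (mul_ne_zero (mul_ne_zero (by norm_num) ?_) (sub_ne_zero.mpr h1))
      ?_) (Complex.Gamma_ne_zero hsm)
    · intro h; rw [h, zero_re] at hs0; exact lt_irrefl _ hs0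
    · rw [cpow_def_of_ne_zero hA0]; exact exp_ne_zero _
  have hprefd : DifferentiableAt ℂ pref s := by
    simp only [hpref]
    exact ((by fun_prop : DifferentiableAt ℂ (fun z : ℂ => 1 / 2 * z * (z - 1)) s).mul
      (differentiableAt_id.const_cpow (Or.inl hA0))).mul (Complex.differentiableAt_Gamma s hsm)
  have hζ0 : riemannZeta s ≠ 0 := riemannZeta_ne_zero_of_one_lt_re hs
  have hζd : DifferentiableAt ℂ riemannZeta s := differentiableAt_riemannZeta h1
  have hN : (discr K).natAbs ≠ 0 := Int.natAbs_ne_zero.mpr (discr_ne_zero K)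
  have hL0 : L ↗χ s ≠ 0 := DirichletCharacter.LSeries_ne_zero_of_one_lt_re χ hs
  have hs' : LSeries.abscissaOfAbsConv ↗χ < s.re := by
    rw [DirichletCharacter.absicssaOfAbsConv_eq_one hN χ]; exact_mod_cast hs
  have hLd : DifferentiableAt ℂ (L ↗χ) s := (LSeries_hasDerivAt hs').differentiableAt
  -- split the logarithmic derivative
  rw [logDeriv_mul (f := pref) (g := fun z => riemannZeta z * L ↗χ z) s hpref0
      (mul_ne_zero hζ0 hL0) hprefd (hζd.mul hLd),
    logDeriv_mul (f := riemannZeta) (g := L ↗χ) s hζ0 hL0 hζd hLd]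
  have hP : logDeriv pref s = 1 / s + 1 / (s - 1) + Real.log (lagariasA K) + digamma s :=
    logDeriv_prefactor (lagariasA_pos (K := K)) hs0 h1
  have hZ : logDeriv riemannZeta s = - L ↗Λ s := by
    rw [logDeriv_apply, ArithmeticFunction.LSeries_vonMangoldt_eq_deriv_riemannZeta_div hs]; ring
  have hLχ : logDeriv (L ↗χ) s = - L (↗χ * ↗Λ) s := by
    rw [logDeriv_apply, DirichletCharacter.LSeries_twist_vonMangoldt_eq χ hs]; ring
  rw [hP, hZ, hLχ]; ring

end Literature.NumberTheory.LFunctions.Lagarias1999
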